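import Literature.AlgebraicGeometry.HodgeTheory.SpreadAlgebraicClassesPencil
import Literature.AlgebraicGeometry.HodgeTheory.GlobalInvariantCycles
import HarnessLib

/-!
# Spreading fibrewise algebraic supports over a smooth curve (named fact)

Topic `Literature/AlgebraicGeometry/HodgeTheory` (family `hodge`). The general one-parameter form
of the tree's named fact `spread_supports_over_projectiveLine` (`SpreadAlgebraicClassesPencil.lean`,
statement (I) there, whose `TODO(general form)` asks for "any smooth projective family over a
smooth quasi-projective curve"): the base `ℙ¹` is replaced by an arbitrary smooth irreducible
complex curve `T`, and the smooth projective total space `X → ℙ¹` by a FLAT PROPER morphism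
`f : W ⟶ T` from a QUASI-PROJECTIVE complex scheme `W` (so `f` is a projective morphism:
EGA II 5.5.3, Hartshorne II Ex. 4.9 — the setting of the printed sources, in which the relative
Hilbert schemes `Hilb(W_U/U)` exist and have projective components, Kollár Thm. I.1.4), whose
fibres off a proper Zariski-closed `S ⊊ T` are smooth projective `d`-folds. For a class
`c ∈ H^{2q}(W(ℂ); ℂ)`, `1 ≤ q ≤ d`, algebraic on EVERY such fibre (`c|_{W_t} ∈ algebraicClasses`,
i.e. supported on a Zariski-closed subset of codimension `≥ q` — the tree's definition), the fact
gives ONE Zariski-closed `𝒵 ⊆ W` and a larger proper Zariski-closed `S' ⊇ S` such that `c|_{W_t}`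
dies off the slice `𝒵_t` for every complex `t` off `S'`, and such that EVERY slice of `𝒵` —
including the slices over the bad points — has dimension `≤ d - q` pointwise
(`Order.height m + q ≤ d`: heights in the specialisation order are dimensions of closures of
points, `Literature/AlgebraicGeometry/Dimension/PointDimension`).

Printed proof (Voisin, *Hodge Theory II*, §3.3.1 with the device of the proof of Thm. 10.19;
Charles–Schnell, proof of Prop. 11.3.11; Arapura 2022, proof of Cor. 1.5; Fulton 1998 §10.1): over
the good locus `U = T ∖ S` the morphism `f` is a smooth projective family; the tuples
`(t, Z₁, …, Z_m)` of codimension-`q` subschemes of `W_t` are the complex points of countably many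
fibre products `H` over `U` of components of the relative Hilbert scheme `Hilb(W_U/U)`, proper over
`U`; the GOOD sets `{c|_{W_t} dies off Z₁ ∪ ⋯ ∪ Z_m} ⊆ H(ℂ)` are unions of connected components
(classes of flat families and the restrictions `c|_{W_t}` are flat sections of `R^{2q} f_* ℂ` pulled
back to `H(ℂ)`), so their images in `U` are Zariski closed; these countably many closed images
cover the uncountable `U(ℂ)` (every `c|_{W_t}` is algebraic), so one good `G ⊆ H` dominates `U`
(a proper closed subset of the irreducible curve `U` is finite); a closed curve `C ⊆ G` dominating
`U`, finite over a dense open `U' ⊆ U`, carries the universal supports; `𝒵 :=` the closure in `W`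
of the union of the supports over `C|_{U'}`, `S' := T ∖ U'`. For `t ∈ U'(ℂ)` the class `c|_{W_t}`
dies off the support over any point of `C` over `t`, hence off the larger `𝒵_t`. The dimension
bound: `𝒵` is the closure of a family of `(d-q)`-dimensional supports over the curve `C|_{U'}`,
so its irreducible components dominate `T` and have dimension `≤ d - q + 1`; their slices over
EVERY complex point of the smooth curve `T` have dimension `≤ d - q` ("the specialisation of a
`k`-cycle is a `k`-cycle": Fulton §10.1, Hartshorne III.9.6 — the components are flat over `T`,
III.9.7). On the tree's carriers the Hilbert schemes may be replaced by the complete hyperplane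
witness families of `AlgebraicityLocusWitnesses` (which use the projective embedding of `W`) with
the generic dichotomy of `AlgebraicityLocusDichotomy`; this file only NAMES the statement.

## Design

* Hypotheses mirror (I): `T` is any `ℂ`-scheme smooth of relative dimension `1` with irreducible
  underlying space (not necessarily separated or quasi-compact: the statement is insensitive to
  shrinking `T` to an affine open dense and enlarging `S'` by the complement); flatness of `f`
  makes `f` smooth along the good fibres (fibre criterion) and is what the consumer has; no
  rationality or Hodge-type hypothesis on `c` is needed. `IsQuasiProjectiveOver W` keeps
  the statement inside the printed (projective-morphism) setting; for `f` merely proper the same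
  conclusion is expected (Chow's lemma, or Artin's Hilbert algebraic space) but is not printed and
  not claimed here.
* The support bound is fibrewise and phrased by `Order.height` (dimension of the closure of the
  point in the fibre), which is meaningful on the singular fibres over `S'`; on a smooth projective
  `d`-dimensional fibre it is the codimension bound `q ≤ Order.coheight m` of `supportedClasses`
  (`HodgeTheory.le_coheight_iff_height_add_le`).
* Consumer: the support item `SpecialisationOfAlgebraicity` of route
  `HodgeConjecture/LimitExtension` (specialisation of algebraicity modulo coniveau one at a
  degenerate fibre `t₀ ∈ S`), via `Summits/HodgeConjecture/HodgeConjecture/Theorems/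
  LimitExtensionSpecialisationOfAlgebraicityOfLocalSpread`.

## References

* [VoisinHodgeII2003] C. Voisin, Hodge Theory and Complex Algebraic Geometry II (2003), §3.3.1;
  §10.2.1, proof of Thm. 10.19.
* [CharlesSchnell2014Notes] F. Charles, C. Schnell, Notes on absolute Hodge classes (2014),
  Prop. 11.3.11 (proof).
* [Arapura2022] D. Arapura, Hodge cycles and the Leray filtration (2022), Cor. 1.5 (proof).
* [Kollar1996] J. Kollár, Rational Curves on Algebraic Varieties (1996), Thm. I.1.4.
* [Fulton1998] W. Fulton, Intersection Theory (1998), §10.1, Prop. 10.3.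
* [Hartshorne1977] R. Hartshorne, Algebraic Geometry (1977), III Prop. 9.7, Cor. 9.6, II Ex. 4.9.
-/

noncomputable section

open CategoryTheory AlgebraicGeometry

namespace Literature.AlgebraicGeometry.HodgeTheory

section HodgeTheory

open Literature.AlgebraicGeometry.Motives

/-- **Spreading fibrewise algebraic supports over a smooth curve** (named fact; the general
one-parameter form of `spread_supports_over_projectiveLine`). Let `T` be a complex scheme smooth
of relative dimension `1` with irreducible underlying space, `W` a quasi-projective complex scheme,
`f : W ⟶ T` flat and proper, `1 ≤ q ≤ d`, and `S ⊊ T` Zariski-closed such that the fibre `W_t`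
over every complex point `t ∉ S` is a smooth projective `d`-fold (so that `f` is a smooth
projective family over `T ∖ S`, EGA IV 17.5.1). If `c ∈ H^{2q}(W(ℂ); ℂ)` restricts to an
algebraic class on every such fibre (`c|_{W_t} ∈ Nᵠ H^{2q}(W_t(ℂ); ℂ)`, the `ℂ`-span of cycle
classes), then there are ONE Zariski-closed `𝒵 ⊆ W`, all of whose slices `𝒵_t = ι_t⁻¹ 𝒵` over
complex points have dimension `≤ d - q` pointwise (`height m + q ≤ d`), and a proper Zariski-closed
`S' ⊇ S` such that `c|_{W_t}` dies off `𝒵_t` for every complex `t ∉ S'`. Printed argument: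
relative Hilbert schemes of the projective family `W_U → U = T ∖ S` (Kollár Thm. I.1.4),
countably many proper parameter spaces whose good sets are unions of connected components, Baire
on the uncountable `U(ℂ)` against the finite proper closed subsets of the curve, a dominating good
component and a multisection curve (Voisin II §3.3.1 and proof of Thm. 10.19; Charles–Schnell,
proof of Prop. 11.3.11; Arapura 2022, proof of Cor. 1.5), closure in `W`; the slices of the
closure of a family of `(d-q)`-dimensional supports over a curve are `(d-q)`-dimensional
(Fulton §10.1; Hartshorne III.9.6–9.7).
[cite: VoisinHodgeII2003, §3.3.1 and §10.2.1, proof of Thm. 10.19]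
[cite: CharlesSchnell2014Notes, Prop. 11.3.11 (proof)] [cite: Arapura2022, Cor. 1.5 (proof)]
[cite: Kollar1996, Thm. I.1.4] [cite: Fulton1998, §10.1, Prop. 10.3] -/
def spread_supports_over_smoothCurve : Prop :=
  ∀ ⦃d q : ℕ⦄ ⦃T W : SchemeOver ℂ⦄ (f : W ⟶ T),
    SmoothOfRelativeDimension 1 T.hom → IrreducibleSpace T.left → IsQuasiProjectiveOver W →
    Flat f.left → IsProper f.left → 1 ≤ q → q ≤ d →
    ∀ S : Set T.left, IsClosed S → S ≠ Set.univ →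
      (∀ t : ComplexPoints T, t.pt ∉ S → IsSmoothProjective d (fiberOver f t)) →
      ∀ c : complexBetti W (2 * q),
        (∀ t : ComplexPoints T, t.pt ∉ S →
          complexBetti.map (fiberι f t) (2 * q) c ∈ algebraicClasses (fiberOver f t) q) →
        ∃ 𝒵 : Set W.left, IsClosed 𝒵 ∧
          (∀ (t : ComplexPoints T) (m : ↥(fiberOver f t).left),
            (fiberι f t).left.base m ∈ 𝒵 → Order.height m + q ≤ (d : ℕ∞)) ∧
          ∃ S' : Set T.left, IsClosed S' ∧ S ⊆ S' ∧ S' ≠ Set.univ ∧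
            ∀ t : ComplexPoints T, t.pt ∉ S' →
              complexBetti.restrictCompl (fiberOver f t) ((fiberι f t).left.base ⁻¹' 𝒵) (2 * q)
                (complexBetti.map (fiberι f t) (2 * q) c) = 0

-- TODO(general form): base of any dimension (spreading over a multisection of a dominating good
-- component), and `f` merely proper (Chow's lemma / Hilbert algebraic spaces); stated over a curve
-- for a projective morphism, the case of one-parameter degenerations.

end HodgeTheory

end Literature.AlgebraicGeometry.HodgeTheory

end
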